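import Summits.KontsevichZagierPeriods.KontsevichZagierPeriods.Theorems.LiouvilleUnfoldingAyoubPiLocalKernelPositivePoints

/-!
# Item stmt-KontsevichZagierPeriods-0541, line `SketchIdeator2` (nilradical cut):
# rigidity of BOUNDED additive functionals on the formal period ring

Support file (`--supports` stmt-KontsevichZagierPeriods-0541), registered stub
`additive_eq_mul_evalP_of_bounded`.  Let `P := KZ.FormalPeriodRing = FormalRep ⧸ relations` be the
formal period ring of the four-move calculus (`KZRulesAssociator.lean`) and `evalP : P →+* ℝ` the
evaluation.  The landed negative file `KillShape` says a refutation of item 0541 must come from an exotic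
ADDITIVE move-invariant functional, and `additive_eq_mul_evalP_of_monotone`
(`Theorems/LiouvilleUnfoldingAyoubPiLocalKernelPositivePoints.lean`) shows that a MONOTONE additive
`θ : P →+ ℝ` is `θ 1 · evalP`.  This file replaces "monotone" by "bounded on small bodies":

**Theorem** (`additive_eq_mul_evalP_of_bounded`).  If `θ : P →+ ℝ` is additive and there is `M` with
`|θ ⟦∫_A 1⟧| ≤ M` for every bounded volume form `A` (bounded domain, integrand `1` on it, any dimension)
of volume `≤ 1`, then `θ x = θ 1 · evalP x` for every `x : P`.  So an `ℝ`-valued additive kill of item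
0541 must be UNBOUNDED on bodies of volume `≤ 1`.

Proof, entirely inside the calculus (no transcendence input), for the pulled-back move-invariant
functional `φ := θ ∘ toFormalPeriod : FormalRep →+ ℝ`:

* *small bodies are small* (`bddInvariant_natCast_mul_abs_le`): `n` disjoint translates of a bounded
  volume form `K` merge into one bounded volume form of volume `n · vol K` (`KZ.exists_merge`), so
  `n · vol K ≤ 1 ⟹ n · |φ [K]| ≤ M`;
* *pinning* (`bddInvariant_of_eq_mul_value`): for a bounded volume form `A` of dimension `k + 1` and a
  rational `q = a / b` just above `vol A`, the rational box `R` of volume `a / b` has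
  `φ [R] = (a/b) · φ [0,1]^{k+1}` (`exists_rationalBox_moveInvariant`) and `[R] − [A] ≡ [K]` with `K`
  a compact body of volume `q − vol A` (Viu-Sos packing,
  `KZ.exists_isCompact_of_sub_of_sub_mem_relations`); both error terms are `O(1/n)`, whence
  `φ [A] = vol A · φ [0,1]^{k+1}` (Archimedes);
* the constant does not depend on `k` (unit slabs, `exists_isBounded_lift_of_le`;
  `bddInvariant_of_cube_eq`), and every formal combination is `≡ [A] − [B]` with `A`, `B` bounded
  volume forms of one dimension (`stub_boundedDecomposition`), so `φ = φ [0,1] · eval`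
  (`bddInvariant_eq_mul_eval`); finally `θ 1 = θ ⟦[pt, 1]⟧ = φ [0,1]` and `toFormalPeriod` is onto.

References: M. Kontsevich, D. Zagier, *Periods* (2001), §1.2; J. Ayoub, EMS Newsl. 91 (2014), Conj. 7;
J. Viu-Sos, *A semi-canonical reduction for periods of Kontsevich–Zagier* (2021), §4.  No definition is
introduced.
-/

noncomputable section

open Set
open Literature.NumberTheory.Transcendental

namespace Summit.KontsevichZagierPeriods.LiouvilleUnfolding.NilradicalCut

open Summit.KontsevichZagierPeriods.KernelForm.LocaliseAtValuePrime

/-! ### Move-invariant functionals bounded on small bodies -/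

/-- **Small bodies are small.** If a move-invariant functional `φ` is bounded by `M` on bounded volume
forms of volume `≤ 1`, then `n · |φ [A]| ≤ M` for every bounded volume form `A` of dimension `k + 1`
with `n · vol A ≤ 1`: `n` disjoint translates of `A` merge into one bounded volume form of volume
`n · vol A` (`KZ.exists_merge`). [folklore] -/
theorem bddInvariant_natCast_mul_abs_le {φ : KZ.FormalRep →+ ℝ} {M : ℝ}
    (h0 : ∀ c ∈ KZ.relations, φ c = 0)
    (hb : ∀ (m : ℕ) (A : KZ.IntegralRep m), Bornology.IsBounded A.domain →
      (∀ x ∈ A.domain, A.integrand x = 1) → A.value ≤ 1 → |φ (KZ.of A)| ≤ M)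
    {k : ℕ} (A : KZ.IntegralRep (k + 1)) (hA : Bornology.IsBounded A.domain)
    (hA1 : ∀ x ∈ A.domain, A.integrand x = 1) (n : ℕ) (hn : (n : ℝ) * A.value ≤ 1) :
    (n : ℝ) * |φ (KZ.of A)| ≤ M := by
  obtain ⟨K, hKb, hK1, hrel⟩ :=
    KZ.exists_merge (Finset.range n) (fun _ => A) (fun _ _ => hA) (fun _ _ => hA1)
  have hKv : K.value = n * A.value := by
    have h := KZ.eval_eq_zero_of_mem_relations hrel
    simp only [map_sub, Finset.sum_const, Finset.card_range, map_nsmul, KZ.eval_of,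
      nsmul_eq_mul] at h
    linarith
  have hKφ : φ (KZ.of K) = n * φ (KZ.of A) := by
    have h := h0 _ hrel
    simp only [map_sub, Finset.sum_const, Finset.card_range, map_nsmul, nsmul_eq_mul] at h
    linarith
  have h := hb _ K hKb hK1 (by rw [hKv]; exact hn)
  rwa [hKφ, abs_mul, Nat.abs_cast] at h

/-- **Pinning on bounded volume forms.** For a move-invariant functional `φ` bounded on bounded volume
forms of volume `≤ 1` and a bounded volume form `A` of dimension `k + 1`,
`φ [A] = φ [0,1]^{k+1} · vol(A)`: a rational box `R` of volume `q = a/b ∈ (vol A, vol A + 1/n)` has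
`φ [R] = q · φ [0,1]^{k+1}` (`exists_rationalBox_moveInvariant`), `[R] − [A] ≡ [K]` with `K` a compact
body of volume `q − vol A < 1/n` (Viu-Sos packing), and `|φ [K]| ≤ M / n`
(`bddInvariant_natCast_mul_abs_le`); let `n → ∞` (Archimedes). [folklore] -/
theorem bddInvariant_of_eq_mul_value {φ : KZ.FormalRep →+ ℝ} {M : ℝ}
    (h0 : ∀ c ∈ KZ.relations, φ c = 0)
    (hb : ∀ (m : ℕ) (A : KZ.IntegralRep m), Bornology.IsBounded A.domain →
      (∀ x ∈ A.domain, A.integrand x = 1) → A.value ≤ 1 → |φ (KZ.of A)| ≤ M)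
    {k : ℕ} (U : KZ.IntegralRep (k + 1)) (hUd : U.domain = KZ.cube (k + 1))
    (hUi : U.integrand = fun _ => 1)
    (A : KZ.IntegralRep (k + 1)) (hA : Bornology.IsBounded A.domain)
    (hA1 : ∀ x ∈ A.domain, A.integrand x = 1) :
    φ (KZ.of A) = φ (KZ.of U) * A.value := by
  have hUv : U.value = 1 := by
    rw [KZ.IntegralRep.value_eq_volume_real U (fun x _ => by rw [hUi]), hUd, KZ.volume_real_cube]
  have hUM : |φ (KZ.of U)| ≤ M :=
    hb _ U (hUd ▸ KZ.isCompact_cube.isBounded) (fun x _ => by rw [hUi]) (by rw [hUv])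
  have hM0 : 0 ≤ M := (abs_nonneg _).trans hUM
  have hv : 0 ≤ A.value := by
    rw [A.value_eq_volume_real hA1]; exact MeasureTheory.measureReal_nonneg
  refine eq_of_forall_dist_le fun ε hε => ?_
  rw [Real.dist_eq]
  -- an integer `N > 2M / ε`
  obtain ⟨N, hN⟩ := exists_nat_gt (2 * M / ε)
  have hN0 : (0 : ℝ) < N := lt_of_le_of_lt (by positivity) hN
  have hMN : M / N < ε / 2 := by
    rw [div_lt_iff₀ hN0]
    rw [div_lt_iff₀ hε] at hN
    linarith
  -- a rational volume `q` just above `vol A`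
  obtain ⟨q, hq₁, hq₂⟩ := exists_rat_btwn (show A.value < A.value + 1 / N by
    have := one_div_pos.mpr hN0; linarith)
  have hq0 : (0 : ℝ) < q := hv.trans_lt hq₁
  obtain ⟨a, b, ha, hb', hab⟩ := exists_nat_div_eq_of_pos q (by exact_mod_cast hq0)
  obtain ⟨R, hRb, hR1, hRv, hRφ⟩ := exists_rationalBox_moveInvariant h0 ha hb' U hUd hUi
  rw [← hab] at hRv hRφ
  -- the excess of the box `R` over `A` is a small compact body `K`
  obtain ⟨K, hKc, -, hK1, hrel⟩ :=
    KZ.exists_isCompact_of_sub_of_sub_mem_relations R A hRb hA hR1 hA1 (by rw [hRv]; exact hq₁)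
  have hKv : K.value = q - A.value := by
    have h := KZ.eval_eq_zero_of_mem_relations hrel
    rw [map_sub, map_sub, KZ.eval_of, KZ.eval_of, KZ.eval_of, hRv] at h
    linarith
  have hKφ : φ (KZ.of K) = q * φ (KZ.of U) - φ (KZ.of A) := by
    have h := h0 _ hrel
    rw [map_sub, map_sub, hRφ] at h
    linarith
  have hqa : (q : ℝ) - A.value ≤ 1 / N := by linarith
  have hKs : |φ (KZ.of K)| ≤ M / N := by
    have h1 : (N : ℝ) * K.value ≤ 1 := by
      rw [hKv]
      calc (N : ℝ) * (q - A.value) ≤ N * (1 / N) :=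
            mul_le_mul_of_nonneg_left hqa hN0.le
        _ = 1 := mul_one_div_cancel hN0.ne'
    have h2 := bddInvariant_natCast_mul_abs_le h0 hb K hKc.isBounded hK1 N h1
    rw [le_div_iff₀ hN0, mul_comm]
    exact h2
  have e : φ (KZ.of A) - φ (KZ.of U) * A.value =
      φ (KZ.of U) * (q - A.value) - φ (KZ.of K) := by
    rw [hKφ]; ring
  rw [e]
  calc |φ (KZ.of U) * (q - A.value) - φ (KZ.of K)|
      ≤ |φ (KZ.of U) * (q - A.value)| + |φ (KZ.of K)| := abs_sub _ _
    _ = |φ (KZ.of U)| * (q - A.value) + |φ (KZ.of K)| := by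
      rw [abs_mul, abs_of_pos (sub_pos.mpr hq₁)]
    _ ≤ M * (1 / N) + M / N := by
      have := mul_le_mul hUM hqa (sub_pos.mpr hq₁).le hM0
      linarith
    _ ≤ ε / 2 + ε / 2 := by rw [mul_one_div]; linarith
    _ = ε := add_halves ε

/-- **The constant does not depend on the dimension**: `φ [0,1]^{k+1} = φ [0,1]^{N+1}` for `k ≤ N`
(raise the cube by unit slabs, `exists_isBounded_lift_of_le`, and pin in the larger dimension).
[folklore] -/
theorem bddInvariant_of_cube_eq {φ : KZ.FormalRep →+ ℝ} {M : ℝ}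
    (h0 : ∀ c ∈ KZ.relations, φ c = 0)
    (hb : ∀ (m : ℕ) (A : KZ.IntegralRep m), Bornology.IsBounded A.domain →
      (∀ x ∈ A.domain, A.integrand x = 1) → A.value ≤ 1 → |φ (KZ.of A)| ≤ M)
    {k N : ℕ} (hkN : k ≤ N) (U : KZ.IntegralRep (k + 1)) (hUd : U.domain = KZ.cube (k + 1))
    (hUi : U.integrand = fun _ => 1) (V : KZ.IntegralRep (N + 1)) (hVd : V.domain = KZ.cube (N + 1))
    (hVi : V.integrand = fun _ => 1) : φ (KZ.of U) = φ (KZ.of V) := by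
  obtain ⟨A', hb', h1', e⟩ := exists_isBounded_lift_of_le hkN U
    (hUd ▸ KZ.isCompact_cube.isBounded) (fun z _ => by rw [hUi])
  have hUv : U.value = 1 := by
    rw [KZ.IntegralRep.value_eq_volume_real U (fun x _ => by rw [hUi]), hUd, KZ.volume_real_cube]
  have hv : A'.value = 1 := by
    have h := KZ.eval_eq_zero_of_mem_relations e
    rw [map_sub, KZ.eval_of, KZ.eval_of, hUv] at h
    linarith
  rw [moveInvariant_apply_eq_of_sub_mem h0 e, bddInvariant_of_eq_mul_value h0 hb V hVd hVi A' hb' h1',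
    hv, mul_one]

/-- **Rigidity of bounded move-invariant functionals.** Let `φ : KZ.FormalRep →+ ℝ` be additive, vanish
on `KZ.relations`, and be bounded on the bounded volume forms of volume `≤ 1`.  Then
`φ c = φ [0,1] · KZ.eval c` for every formal combination `c` (`[0,1]` = any `U` with
`U.domain = KZ.cube 1`, `U.integrand = 1`): decompose `c ≡ [A] − [B]` into bounded volume forms of one
dimension (`stub_boundedDecomposition`) and pin both. [folklore] -/
theorem bddInvariant_eq_mul_eval {φ : KZ.FormalRep →+ ℝ} {M : ℝ}
    (h0 : ∀ c ∈ KZ.relations, φ c = 0)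
    (hb : ∀ (m : ℕ) (A : KZ.IntegralRep m), Bornology.IsBounded A.domain →
      (∀ x ∈ A.domain, A.integrand x = 1) → A.value ≤ 1 → |φ (KZ.of A)| ≤ M)
    (U : KZ.IntegralRep 1) (hUd : U.domain = KZ.cube 1) (hUi : U.integrand = fun _ => 1)
    (c : KZ.FormalRep) : φ c = φ (KZ.of U) * KZ.eval c := by
  obtain ⟨k, A, B, hAb, hBb, hA1, hB1, e⟩ := stub_boundedDecomposition c
  obtain ⟨V, hVd, hVi⟩ := KZ.exists_oneRep (KZ.isSemialgebraic_cube (n := k + 1)) (by simp)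
  have he : KZ.eval c = A.value - B.value := by
    have h := KZ.eval_eq_zero_of_mem_relations e
    rw [map_sub, map_sub, KZ.eval_of, KZ.eval_of] at h
    linarith
  rw [moveInvariant_apply_eq_of_sub_mem h0 e, map_sub,
    bddInvariant_of_eq_mul_value h0 hb V hVd hVi A hAb hA1,
    bddInvariant_of_eq_mul_value h0 hb V hVd hVi B hBb hB1,
    ← bddInvariant_of_cube_eq h0 hb (Nat.zero_le k) U hUd hUi V hVd hVi, he]
  ring

/-- **Rigidity, existential form**: a move-invariant functional bounded on the bounded volume forms of
volume `≤ 1` is a real multiple of the evaluation. [folklore] -/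
theorem exists_bddInvariant_eq_mul_eval (φ : KZ.FormalRep →+ ℝ) {M : ℝ}
    (h0 : ∀ c ∈ KZ.relations, φ c = 0)
    (hb : ∀ (m : ℕ) (A : KZ.IntegralRep m), Bornology.IsBounded A.domain →
      (∀ x ∈ A.domain, A.integrand x = 1) → A.value ≤ 1 → |φ (KZ.of A)| ≤ M) :
    ∃ l : ℝ, |l| ≤ M ∧ ∀ c, φ c = l * KZ.eval c := by
  obtain ⟨U, hUd, hUi⟩ := KZ.exists_oneRep (KZ.isSemialgebraic_cube (n := 1)) (by simp)
  have hUv : U.value = 1 := by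
    rw [KZ.IntegralRep.value_eq_volume_real U (fun x _ => by rw [hUi]), hUd, KZ.volume_real_cube]
  exact ⟨φ (KZ.of U), hb _ U (hUd ▸ KZ.isCompact_cube.isBounded) (fun x _ => by rw [hUi])
    (by rw [hUv]), bddInvariant_eq_mul_eval h0 hb U hUd hUi⟩

/-- **A bounded move-invariant functional does not see the kernel of the evaluation**: it vanishes on
every formal combination of value `0` — unconditionally, whereas for ARBITRARY move-invariant
functionals this is Conjecture 1 in kernel form. [folklore] -/
theorem bddInvariant_eq_zero_of_eval_eq_zero {φ : KZ.FormalRep →+ ℝ} {M : ℝ}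
    (h0 : ∀ c ∈ KZ.relations, φ c = 0)
    (hb : ∀ (m : ℕ) (A : KZ.IntegralRep m), Bornology.IsBounded A.domain →
      (∀ x ∈ A.domain, A.integrand x = 1) → A.value ≤ 1 → |φ (KZ.of A)| ≤ M)
    {c : KZ.FormalRep} (hc : KZ.eval c = 0) : φ c = 0 := by
  obtain ⟨l, -, hl⟩ := exists_bddInvariant_eq_mul_eval φ h0 hb
  rw [hl, hc, mul_zero]

/-! ### The registered stub: bounded additive functionals on `P` -/

/-- **Rigidity of bounded additive functionals on `P`** (registered stub
`additive_eq_mul_evalP_of_bounded` of line `SketchIdeator2`): an additive `θ : P →+ ℝ` bounded on the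
classes of bounded volume forms of volume `≤ 1` is `θ 1 · evalP`.  Pull back to the move-invariant
functional `θ ∘ toFormalPeriod` on `FormalRep` (`comp_toFormalPeriod_mem_relations`), apply
`bddInvariant_eq_mul_eval`, and identify the constant through `θ 1 = θ ⟦[pt, 1]⟧`
(`KZ.toFormalPeriod_of_unit`, `value [pt, 1] = 1`); `toFormalPeriod` is onto. [folklore] -/
theorem additive_eq_mul_evalP_of_bounded : ∀ θ : KZ.FormalPeriodRing →+ ℝ, (∃ M : ℝ, ∀ (m : ℕ) (A : KZ.IntegralRep m), Bornology.IsBounded A.domain → (∀ x ∈ A.domain, A.integrand x = 1) → A.value ≤ 1 → |θ (KZ.toFormalPeriod (KZ.of A))| ≤ M) → ∀ x : KZ.FormalPeriodRing, θ x = θ 1 * KZ.evalP x := by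
  rintro θ ⟨M, hM⟩ x
  obtain ⟨U, hUd, hUi⟩ := KZ.exists_oneRep (KZ.isSemialgebraic_cube (n := 1)) (by simp)
  have hl : ∀ c, θ (KZ.toFormalPeriod c) = θ (KZ.toFormalPeriod (KZ.of U)) * KZ.eval c := fun c =>
    bddInvariant_eq_mul_eval (φ := θ.comp KZ.toFormalPeriod.toAddMonoidHom)
      (comp_toFormalPeriod_mem_relations θ) (fun m A hA h1 hv => hM m A hA h1 hv) U hUd hUi c
  have h1 : θ 1 = θ (KZ.toFormalPeriod (KZ.of U)) := by
    rw [← KZ.toFormalPeriod_of_unit, hl, KZ.eval_of, KZ.IntegralRep.value_unit, mul_one]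
  obtain ⟨c, rfl⟩ := KZ.toFormalPeriod_surjective x
  rw [hl, h1, KZ.evalP_toFormalPeriod]

/-- **A bounded additive functional on `P` kills the value-kernel.** [folklore] -/
theorem ker_evalP_le_ker_of_bounded_additive (θ : KZ.FormalPeriodRing →+ ℝ)
    (hθ : ∃ M : ℝ, ∀ (m : ℕ) (A : KZ.IntegralRep m), Bornology.IsBounded A.domain →
      (∀ x ∈ A.domain, A.integrand x = 1) → A.value ≤ 1 → |θ (KZ.toFormalPeriod (KZ.of A))| ≤ M)
    {x : KZ.FormalPeriodRing} (hx : KZ.evalP x = 0) : θ x = 0 := by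
  rw [additive_eq_mul_evalP_of_bounded θ hθ, hx, mul_zero]

/-- **Kill shape, sharpened**: an additive `θ : P →+ ℝ` that does NOT factor as `θ 1 · evalP` (in
particular any additive real-valued functional separating two formal periods of equal value) is
unbounded on the classes of bounded volume forms of volume `≤ 1`: for every `M` some bounded volume
form `A` with `vol A ≤ 1` has `M < |θ ⟦∫_A 1⟧|`. [folklore] -/
theorem unbounded_of_ne_mul_evalP (θ : KZ.FormalPeriodRing →+ ℝ) {x : KZ.FormalPeriodRing}
    (hx : θ x ≠ θ 1 * KZ.evalP x) (M : ℝ) :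
    ∃ (m : ℕ) (A : KZ.IntegralRep m), Bornology.IsBounded A.domain ∧
      (∀ z ∈ A.domain, A.integrand z = 1) ∧ A.value ≤ 1 ∧ M < |θ (KZ.toFormalPeriod (KZ.of A))| := by
  by_contra h
  refine hx (additive_eq_mul_evalP_of_bounded θ ⟨M, fun m A hA h1 hv => ?_⟩ x)
  exact not_lt.mp fun hlt => h ⟨m, A, hA, h1, hv, hlt⟩

end Summit.KontsevichZagierPeriods.LiouvilleUnfolding.NilradicalCut

end
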